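import Mathlib
import HarnessLib
import Literature.Computability.LLVMLangRef18.IntegerIntrinsics
import Literature.Computability.LLVMLangRef18.BinaryOperators

/-!
# LLVM Language Reference Manual, release 18.1.3: `bitreverse`, `bswap`, the funnel shifts `fshl`/`fshr`, the manual's definition of "overflows" for `*.with.overflow`, and the saturating shifts `sshl.sat`/`ushl.sat`

Source followed verbatim: *LLVM Language Reference Manual*, release 18.1.3 [LLVMLangRef18] — the file `docs/LangRef.rst` at tag
`llvmorg-18.1.3` (pinned copy `inputs/llvm-18.1.3.src/docs/LangRef.rst` of the CertifiedToolchain cell, 28 110 lines; tarball sha256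
fa6db895…bc00).  Third companion of `IntegerIntrinsics.lean` (min/max/abs, saturating add/sub, bit counting, casts) and `BinaryOperators.lean`
(binary operators, `icmp`, `select`, `freeze`, the `*.with.overflow` structs): it types the sections those two list as "not typed".  Every
declaration carries the section title and the LINE RANGE of the pinned file it transcribes, with the normative sentence quoted.

Printed (§'llvm.bitreverse.*', L16093–16095 and L16100–16101): "The '``llvm.bitreverse``' family of intrinsics is used to reverse the
bitpattern of an integer value or vector of integer values; for example ``0b10110110`` becomes ``0b01101101``."  "The ``llvm.bitreverse.iN``
intrinsic returns an iN value that has bit ``M`` in the input moved to bit ``N-M-1`` in the output."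
Printed (§'llvm.bswap.*', L16113–16114, L16126–16128, L16133–16140): "You can use bswap on any integer type that is an even number of bytes
(i.e. BitWidth % 16 == 0)."  "The '``llvm.bswap``' family of intrinsics is used to byte swap an integer value or vector of integer values
with an even number of bytes (positive multiple of 16 bits)."  "The ``llvm.bswap.i16`` intrinsic returns an i16 value that has the high and
low byte of the input i16 swapped. Similarly, the ``llvm.bswap.i32`` intrinsic returns an i32 value that has the four bytes of the input i32
swapped, so that if the input bytes are numbered 0, 1, 2, 3 then the returned i32 will have its bytes in 3, 2, 1, 0 order. The
``llvm.bswap.i48``, ``llvm.bswap.i64`` and other intrinsics extend this concept to additional even-byte lengths (6 bytes, 8 bytes and more,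
respectively)."
Printed (§'llvm.fshl.*', L16298–16305): "The '``llvm.fshl``' family of intrinsic functions performs a funnel shift left: the first two values
are concatenated as { %a : %b } (%a is the most significant bits of the wide value), the combined value is shifted left, and the most
significant bits are extracted to produce a result that is the same size as the original arguments. If the first 2 arguments are identical,
this is equivalent to a rotate left operation. […] The shift argument is treated as an unsigned amount modulo the element size of the
arguments."  Example block (L16320–16323): "``%r = i8: msb_extract((concat(x, y) << (z % 8)), 8)``", "``fshl.i8(255, 0, 15) = 128``",
"``fshl.i8(15, 15, 11) = 120``", "``fshl.i8(0, 255, 8) = 0``".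
Printed (§'llvm.fshr.*', L16346–16353): "… performs a funnel shift right: the first two values are concatenated as { %a : %b } (%a is the most
significant bits of the wide value), the combined value is shifted right, and the least significant bits are extracted to produce a result
that is the same size as the original arguments. If the first 2 arguments are identical, this is equivalent to a rotate right operation. […]
The shift argument is treated as an unsigned amount modulo the element size of the arguments."  Example block (L16368–16371):
"``lsb_extract((concat(x, y) >> (z % 8)), 8)``", "``fshr.i8(255, 0, 15) = 254``", "``fshr.i8(15, 15, 11) = 225``", "``fshr.i8(0, 255, 8) = 255``".
Printed (§'Arithmetic with Overflow Intrinsics', L16378–16395): "Each of these intrinsics returns a two-element struct. The first element of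
this struct contains the result of the corresponding arithmetic operation modulo 2^n, where n is the bit width of the result. […] The second
element of the result is an ``i1`` that is 1 if the arithmetic operation overflowed and 0 otherwise. An operation overflows if, for any values
of its operands ``A`` and ``B`` and for any ``N`` larger than the operands' width, ``ext(A op B) to iN`` is not equal to ``(ext(A) to iN) op
(ext(B) to iN)`` where ``ext`` is ``sext`` for signed overflow and ``zext`` for unsigned overflow, and ``op`` is the underlying arithmetic
operation.  The behavior of these intrinsics is well-defined for all argument values."
Printed (§'llvm.sshl.sat.*', L16921–16922, L16928–16931, L16939–16941): "perform signed saturating left shift on the first argument."  "``%a``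
is the value to be shifted, and ``%b`` is the amount to shift by. If ``b`` is (statically or dynamically) equal to or larger than the integer
bit width of the arguments, the result is a poison value."  "The maximum value this operation can clamp to is the largest signed value
representable by the bit width of the arguments. The minimum value is the smallest signed value representable by this bit width."  Examples
(L16949–16952): "``sshl.sat.i4(2, 1) = 4``", "``(2, 2) = 7``", "``(-5, 1) = -8``", "``(-1, 1) = -2``".
Printed (§'llvm.ushl.sat.*', L16974–16975, L16981–16984, L16991–16992): "perform unsigned saturating left shift on the first argument." (same
poison clause) "The maximum value this operation can clamp to is the largest unsigned value representable by the bit width of the arguments."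
Examples (L17000–17001): "``ushl.sat.i4(2, 1) = 4``", "``(3, 3) = 15``".

## What is formalised and what is not
Scalar integers only (vector forms omitted).  Values on DEFINED operands are functions on `BitVec w` typed as the sentences say (`…V` names);
the instruction on `⟦iw⟧ = LeeEtAl2017.IVal w` is the poison-STRICT lift per §'Poison Values' L4553–4554 ("Most instructions return
poison when one of their arguments is poison"), the convention of `IntegerIntrinsics` — the intrinsic sections themselves do not restate
poison propagation; where an operand VALUE makes the result poison (`sshl.sat`/`ushl.sat` with `b ≥ w`) the text is explicit and typed
verbatim.  `bitreverse` / `bswap` / `fshl` / `fshr` are typed BIT-LEVEL exactly as printed (bit `M ↦ N−M−1`; byte `j ↦ B−1−j`;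
`msb_extract((concat(a, b) << (c % w)), w)` over Mathlib's `++` / `extractLsb'`) and then related to Lean core's `BitVec.reverse`,
`BitVec.rotateLeft`, `BitVec.rotateRight` by PROVED equations (`bitreverseV_eq_reverse`, `fshlV_self`, `fshrV_self` — the last two are the
manual's "equivalent to a rotate" sentences).  `bswap`: the manual types the intrinsic only at widths with `BitWidth % 16 == 0`; the typing
side condition is the predicate `BswapTyped`, the value function is written for every width by the byte formula (bytes of 8 bits counted from
the least significant end, `B = w / 8`) and is the printed operation exactly on the typed widths (`bswapV_i16`, `bswapV_i32` are the two
printed sentences).  §'Arithmetic with Overflow Intrinsics': `BinaryOperators.lean` formalised "overflowed" by Lean core's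
`BitVec.uaddOverflow` / `usubOverflow` / `saddOverflow` / `ssubOverflow` / `umulOverflow` / `smulOverflow`; THIS file types the manual's own
DEFINITION of "overflows" (L16387–16392: `ext(A op B) to iN ≠ (ext(A) to iN) op (ext(B) to iN)`) as the predicates `…OverflowsAt N A B`,
and READS the quantifier "for any ``N`` larger than the operands' width" EXISTENTIALLY (`…Overflows A B := ∃ N > w, …OverflowsAt N A B`):
for the four add/sub intrinsics the inequality holds at one `N > w` iff at every `N > w` (`uaddOverflows_iff_forall` …), so both readings
agree; for the two mul intrinsics it does NOT (`umulOverflowsAt_depends_on_N`: `i4` operands `8`, `4` give equal extensions at `N = 5` and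
unequal ones at `N = 6`), and only the existential reading makes `umul.with.overflow.i4(8, 4)` report the overflow of `32`; the universal
reading is therefore not the manual's meaning and is not typed.  PROVED: each `…Overflows` equals the core predicate `BinaryOperators` uses
(`uaddOverflows_iff`, `usubOverflows_iff`, `saddOverflows_iff`, `ssubOverflows_iff`, `umulOverflows_iff`, `smulOverflows_iff`), hence equals
the second element of the typed structs (`uaddWithOverflowV_snd` …).  Not typed: the fixed-point intrinsics (§L17004ff), anything about
`undef`, vectors, pointers.  No claim is made about what LLVM's optimiser does with these constructs; this is the specification text only.
-/

namespace Literature.Computability.LLVMLangRef18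

open Literature.Computability.LeeEtAl2017

variable {w : ℕ}

/-! ## Three-operand poison propagation (§'Poison Values') -/

/-- "Most instructions return '``poison``' when one of their arguments is '``poison``'." — the ternary poison-strict lift used by the
funnel shifts. [cite: LLVMLangRef18, §'Poison Values' L4553–4554] -/
def strict₃ (f : BitVec w → BitVec w → BitVec w → IVal w) (a b c : IVal w) : IVal w :=
  a.bind fun x => b.bind fun y => c.bind fun z => f x y z

/-- A poison first operand gives poison. [cite: LLVMLangRef18, §'Poison Values' L4553–4554] -/
@[simp] theorem strict₃_poison₁ (f : BitVec w → BitVec w → BitVec w → IVal w) (b c : IVal w) :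
    strict₃ f IVal.poison b c = IVal.poison := rfl

/-- A poison second operand gives poison. [cite: LLVMLangRef18, §'Poison Values' L4553–4554] -/
@[simp] theorem strict₃_poison₂ (f : BitVec w → BitVec w → BitVec w → IVal w) (a c : IVal w) :
    strict₃ f a IVal.poison c = IVal.poison := by cases a <;> rfl

/-- A poison third operand gives poison. [cite: LLVMLangRef18, §'Poison Values' L4553–4554] -/
@[simp] theorem strict₃_poison₃ (f : BitVec w → BitVec w → BitVec w → IVal w) (a b : IVal w) :
    strict₃ f a b IVal.poison = IVal.poison := by cases a <;> cases b <;> rfl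

/-- Three defined operands give the construct's own clause. [cite: LLVMLangRef18, §'Poison Values' L4553–4554] -/
@[simp] theorem strict₃_some (f : BitVec w → BitVec w → BitVec w → IVal w) (x y z : BitVec w) :
    strict₃ f (some x) (some y) (some z) = f x y z := rfl

/-! ## `llvm.bitreverse` (§'llvm.bitreverse.*' L16072–16103) -/

/-- "The ``llvm.bitreverse.iN`` intrinsic returns an iN value that has bit ``M`` in the input moved to bit ``N-M-1`` in the output" —
equivalently, bit `j` of the output is bit `N-1-j` of the input. [cite: LLVMLangRef18, §'llvm.bitreverse.*' L16100–16101] -/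
def bitreverseV (x : BitVec w) : BitVec w := BitVec.ofFnLE fun j : Fin w => x.getLsbD (w - 1 - (j : ℕ))

/-- `llvm.bitreverse` on `⟦iw⟧` (poison-strict, never creates poison). [cite: LLVMLangRef18, §'llvm.bitreverse.*' L16100–16101;
§'Poison Values' L4553–4554] -/
def bitreverse (a : IVal w) : IVal w := strict₁ (fun x => some (bitreverseV x)) a

/-- Bit `j` of the output is bit `N-1-j` of the input (and there are no bits at `j ≥ N`).
[cite: LLVMLangRef18, §'llvm.bitreverse.*' L16100–16101] -/
theorem getLsbD_bitreverseV (x : BitVec w) (j : ℕ) :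
    (bitreverseV x).getLsbD j = (decide (j < w) && x.getLsbD (w - 1 - j)) := by
  unfold bitreverseV
  rw [BitVec.getLsbD_ofFnLE]
  split <;> simp [*]

/-- The printed sentence literally: "bit ``M`` in the input [is] moved to bit ``N-M-1`` in the output".
[cite: LLVMLangRef18, §'llvm.bitreverse.*' L16100–16101] -/
theorem getLsbD_bitreverseV_moved (x : BitVec w) {M : ℕ} (hM : M < w) :
    (bitreverseV x).getLsbD (w - M - 1) = x.getLsbD M := by
  rw [getLsbD_bitreverseV, decide_eq_true (by omega : w - M - 1 < w), Bool.true_and,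
    show w - 1 - (w - M - 1) = M by omega]

/-- The printed example: "``0b10110110`` becomes ``0b01101101``" (at `i8`). [cite: LLVMLangRef18, §'llvm.bitreverse.*' L16093–16095] -/
theorem bitreverseV_example : bitreverseV (0b10110110#8) = 0b01101101#8 := by
  decide

/-- The typed operation is Lean core's `BitVec.reverse`. [cite: LLVMLangRef18, §'llvm.bitreverse.*' L16100–16101] -/
theorem bitreverseV_eq_reverse (x : BitVec w) : bitreverseV x = x.reverse := by
  apply BitVec.eq_of_getLsbD_eq
  intro i hi
  rw [getLsbD_bitreverseV, BitVec.getLsbD_reverse, BitVec.getMsbD_eq_getLsbD]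

/-! ## `llvm.bswap` (§'llvm.bswap.*' L16105–16141) -/

/-- The TYPING side condition of the intrinsic: "You can use bswap on any integer type that is an even number of bytes (i.e. BitWidth %
16 == 0)." [cite: LLVMLangRef18, §'llvm.bswap.*' L16113–16114] -/
def BswapTyped (w : ℕ) : Prop := w % 16 = 0

/-- `BswapTyped` is a decidable arithmetic condition. [cite: LLVMLangRef18, §'llvm.bswap.*' L16113–16114] -/
instance instDecidableBswapTyped (w : ℕ) : Decidable (BswapTyped w) := inferInstanceAs (Decidable (w % 16 = 0))

/-- Byte swap: "if the input bytes are numbered 0, 1, 2, 3 then the returned i32 will have its bytes in 3, 2, 1, 0 order […] other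
intrinsics extend this concept to additional even-byte lengths" — with `B = w / 8` bytes (byte `k` = bits `8k … 8k+7`), byte `j` of the
result is byte `B-1-j` of the input, i.e. bit `i` of the result is bit `8·(B-1-⌊i/8⌋) + i mod 8` of the input.  Written for every `w`; it is
the intrinsic exactly on the typed widths `BswapTyped w`. [cite: LLVMLangRef18, §'llvm.bswap.*' L16133–16140] -/
def bswapV (x : BitVec w) : BitVec w := BitVec.ofFnLE fun i : Fin w => x.getLsbD (8 * (w / 8 - 1 - (i : ℕ) / 8) + (i : ℕ) % 8)

/-- `llvm.bswap` on `⟦iw⟧` (poison-strict, never creates poison). [cite: LLVMLangRef18, §'llvm.bswap.*' L16133–16140; §'Poison Values'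
L4553–4554] -/
def bswap (a : IVal w) : IVal w := strict₁ (fun x => some (bswapV x)) a

/-- Bit `i` of the byte-swapped value. [cite: LLVMLangRef18, §'llvm.bswap.*' L16133–16140] -/
theorem getLsbD_bswapV (x : BitVec w) (i : ℕ) :
    (bswapV x).getLsbD i = (decide (i < w) && x.getLsbD (8 * (w / 8 - 1 - i / 8) + i % 8)) := by
  unfold bswapV
  rw [BitVec.getLsbD_ofFnLE]
  split <;> simp [*]

/-- "The ``llvm.bswap.i16`` intrinsic returns an i16 value that has the high and low byte of the input i16 swapped": the result is the
input's low byte followed (below it) by the input's high byte. [cite: LLVMLangRef18, §'llvm.bswap.*' L16133–16134] -/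
theorem bswapV_i16 (x : BitVec 16) : bswapV x = x.extractLsb' 0 8 ++ x.extractLsb' 8 8 := by
  apply BitVec.eq_of_getLsbD_eq
  intro i hi
  rw [getLsbD_bswapV, BitVec.getLsbD_append, BitVec.getLsbD_extractLsb', BitVec.getLsbD_extractLsb', decide_eq_true hi,
    Bool.true_and]
  by_cases h8 : i < 8
  · rw [if_pos h8, decide_eq_true h8, Bool.true_and, show 8 * (16 / 8 - 1 - i / 8) + i % 8 = 8 + i by omega]
  · rw [if_neg h8, decide_eq_true (by omega : i - 8 < 8), Bool.true_and,
      show 8 * (16 / 8 - 1 - i / 8) + i % 8 = 0 + (i - 8) by omega]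

/-- "the ``llvm.bswap.i32`` intrinsic returns an i32 value that has the four bytes of the input i32 swapped, so that if the input bytes are
numbered 0, 1, 2, 3 then the returned i32 will have its bytes in 3, 2, 1, 0 order": reading bytes from the most significant end, the result
is byte 0, byte 1, byte 2, byte 3 of the input. [cite: LLVMLangRef18, §'llvm.bswap.*' L16134–16137] -/
theorem bswapV_i32 (x : BitVec 32) :
    bswapV x = x.extractLsb' 0 8 ++ x.extractLsb' 8 8 ++ x.extractLsb' 16 8 ++ x.extractLsb' 24 8 := by
  apply BitVec.eq_of_getLsbD_eq
  intro i hi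
  simp only [getLsbD_bswapV, BitVec.getLsbD_append, BitVec.getLsbD_extractLsb', decide_eq_true hi, Bool.true_and]
  by_cases h1 : i < 8
  · rw [if_pos h1, decide_eq_true h1, Bool.true_and, show 8 * (32 / 8 - 1 - i / 8) + i % 8 = 24 + i by omega]
  rw [if_neg h1]
  by_cases h2 : i - 8 < 8
  · rw [if_pos h2, decide_eq_true h2, Bool.true_and, show 8 * (32 / 8 - 1 - i / 8) + i % 8 = 16 + (i - 8) by omega]
  rw [if_neg h2]
  by_cases h3 : i - 8 - 8 < 8
  · rw [if_pos h3, decide_eq_true h3, Bool.true_and, show 8 * (32 / 8 - 1 - i / 8) + i % 8 = 8 + (i - 8 - 8) by omega]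
  · rw [if_neg h3, decide_eq_true (by omega : i - 8 - 8 - 8 < 8), Bool.true_and,
      show 8 * (32 / 8 - 1 - i / 8) + i % 8 = 0 + (i - 8 - 8 - 8) by omega]

/-- `i16`, `i32`, `i48`, `i64` are typed widths; `i8` and `i24` are not ("even number of bytes").
[cite: LLVMLangRef18, §'llvm.bswap.*' L16113–16114 and L16137–16140] -/
theorem bswapTyped_examples :
    BswapTyped 16 ∧ BswapTyped 32 ∧ BswapTyped 48 ∧ BswapTyped 64 ∧ ¬BswapTyped 8 ∧ ¬BswapTyped 24 := by
  decide

/-! ## `llvm.fshl` / `llvm.fshr` (§'llvm.fshl.*' L16277–16323, §'llvm.fshr.*' L16325–16371) -/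

/-- Funnel shift left on defined operands: "the first two values are concatenated as { %a : %b } (%a is the most significant bits of the
wide value), the combined value is shifted left, and the most significant bits are extracted to produce a result that is the same size as
the original arguments. […] The shift argument is treated as an unsigned amount modulo the element size of the arguments." — the printed
formula `msb_extract((concat(a, b) << (c % w)), w)`. [cite: LLVMLangRef18, §'llvm.fshl.*' L16298–16305 and L16320] -/
def fshlV (a b c : BitVec w) : BitVec w := BitVec.extractLsb' w w ((a ++ b) <<< (c.toNat % w))

/-- Funnel shift right on defined operands: "… the combined value is shifted right, and the least significant bits are extracted …" — the
printed formula `lsb_extract((concat(a, b) >> (c % w)), w)`. [cite: LLVMLangRef18, §'llvm.fshr.*' L16346–16353 and L16368] -/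
def fshrV (a b c : BitVec w) : BitVec w := BitVec.extractLsb' 0 w ((a ++ b) >>> (c.toNat % w))

/-- `llvm.fshl` on `⟦iw⟧` (poison-strict in all three operands; never creates poison). [cite: LLVMLangRef18, §'llvm.fshl.*'
L16298–16305; §'Poison Values' L4553–4554] -/
def fshl (a b c : IVal w) : IVal w := strict₃ (fun x y z => some (fshlV x y z)) a b c

/-- `llvm.fshr` on `⟦iw⟧`. [cite: LLVMLangRef18, §'llvm.fshr.*' L16346–16353; §'Poison Values' L4553–4554] -/
def fshr (a b c : IVal w) : IVal w := strict₃ (fun x y z => some (fshrV x y z)) a b c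

/-- The three printed `i8` examples of `fshl`: `(255, 0, 15) = 128`, `(15, 15, 11) = 120`, `(0, 255, 8) = 0` (amounts `15`, `11`, `8`
exercise the "modulo the element size" clause). [cite: LLVMLangRef18, §'llvm.fshl.*' L16321–16323] -/
theorem fshlV_examples :
    fshlV (255#8) (0#8) (15#8) = 128#8 ∧ fshlV (15#8) (15#8) (11#8) = 120#8 ∧ fshlV (0#8) (255#8) (8#8) = 0#8 := by
  decide

/-- The three printed `i8` examples of `fshr`: `(255, 0, 15) = 254`, `(15, 15, 11) = 225`, `(0, 255, 8) = 255`.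
[cite: LLVMLangRef18, §'llvm.fshr.*' L16369–16371] -/
theorem fshrV_examples :
    fshrV (255#8) (0#8) (15#8) = 254#8 ∧ fshrV (15#8) (15#8) (11#8) = 225#8 ∧ fshrV (0#8) (255#8) (8#8) = 255#8 := by
  decide

/-- Bit `i < w` of `fshl a b c`, with `k = c mod w`: `a[i-k]` when `k ≤ i`, else `b[i+w-k]` (the top `k` bits of `b` move in below the
low `w-k` bits of `a`). [cite: LLVMLangRef18, §'llvm.fshl.*' L16298–16305] -/
theorem getLsbD_fshlV (a b c : BitVec w) {i : ℕ} (hi : i < w) :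
    (fshlV a b c).getLsbD i =
      if c.toNat % w ≤ i then a.getLsbD (i - c.toNat % w) else b.getLsbD (i + w - c.toNat % w) := by
  have hk : c.toNat % w < w := Nat.mod_lt _ (by omega)
  unfold fshlV
  rw [BitVec.getLsbD_extractLsb', BitVec.getLsbD_shiftLeft, BitVec.getLsbD_append, decide_eq_true hi, Bool.true_and,
    decide_eq_true (by omega : w + i < w + w), Bool.true_and, decide_eq_false (by omega : ¬(w + i < c.toNat % w)), Bool.not_false,
    Bool.true_and]
  by_cases hle : c.toNat % w ≤ i
  · rw [if_pos hle, if_neg (by omega), show w + i - c.toNat % w - w = i - c.toNat % w by omega]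
  · rw [if_neg hle, if_pos (by omega), show w + i - c.toNat % w = i + w - c.toNat % w by omega]

/-- Bit `i < w` of `fshr a b c`, with `k = c mod w`: `b[k+i]` while `k+i < w`, else `a[k+i-w]` (the low `k` bits of `a` move in above the
high `w-k` bits of `b`). [cite: LLVMLangRef18, §'llvm.fshr.*' L16346–16353] -/
theorem getLsbD_fshrV (a b c : BitVec w) {i : ℕ} (hi : i < w) :
    (fshrV a b c).getLsbD i =
      if c.toNat % w + i < w then b.getLsbD (c.toNat % w + i) else a.getLsbD (c.toNat % w + i - w) := by
  unfold fshrV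
  rw [BitVec.getLsbD_extractLsb', BitVec.getLsbD_ushiftRight, BitVec.getLsbD_append, decide_eq_true hi, Bool.true_and, Nat.zero_add]

/-- "If the first 2 arguments are identical, this is equivalent to a rotate left operation" (by the amount, modulo the width; Lean core's
`BitVec.rotateLeft`). [cite: LLVMLangRef18, §'llvm.fshl.*' L16302–16303] -/
theorem fshlV_self (a c : BitVec w) : fshlV a a c = a.rotateLeft c.toNat := by
  apply BitVec.eq_of_getLsbD_eq
  intro i hi
  have hk : c.toNat % w < w := Nat.mod_lt _ (by omega)
  rw [getLsbD_fshlV a a c hi, BitVec.getLsbD_rotateLeft]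
  by_cases hle : c.toNat % w ≤ i
  · rw [if_pos hle]
    simp only [show ¬(i < c.toNat % w) by omega, decide_false, cond_false, hi, decide_true, Bool.true_and]
  · rw [if_neg hle]
    simp only [show i < c.toNat % w by omega, decide_true, cond_true, show w - c.toNat % w + i = i + w - c.toNat % w by omega]

/-- "If the first 2 arguments are identical, this is equivalent to a rotate right operation" (Lean core's `BitVec.rotateRight`).
[cite: LLVMLangRef18, §'llvm.fshr.*' L16350–16351] -/
theorem fshrV_self (a c : BitVec w) : fshrV a a c = a.rotateRight c.toNat := by
  apply BitVec.eq_of_getLsbD_eq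
  intro i hi
  have hk : c.toNat % w < w := Nat.mod_lt _ (by omega)
  rw [getLsbD_fshrV a a c hi, BitVec.getLsbD_rotateRight]
  by_cases hlt : c.toNat % w + i < w
  · rw [if_pos hlt]
    simp only [show i < w - c.toNat % w by omega, decide_true, cond_true]
  · rw [if_neg hlt]
    simp only [show ¬(i < w - c.toNat % w) by omega, decide_false, cond_false, hi, decide_true, Bool.true_and,
      show i - (w - c.toNat % w) = c.toNat % w + i - w by omega]

/-- A zero shift amount (modulo the width) returns the first operand for `fshl` … [cite: LLVMLangRef18, §'llvm.fshl.*' L16298–16305] -/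
theorem fshlV_of_mod_eq_zero (a b c : BitVec w) (h : c.toNat % w = 0) : fshlV a b c = a := by
  apply BitVec.eq_of_getLsbD_eq
  intro i hi
  rw [getLsbD_fshlV a b c hi, h, if_pos (Nat.zero_le i), Nat.sub_zero]

/-- … and the second operand for `fshr` (third printed example of each: amount `8` at `i8`). [cite: LLVMLangRef18, §'llvm.fshr.*'
L16346–16353 and L16371] -/
theorem fshrV_of_mod_eq_zero (a b c : BitVec w) (h : c.toNat % w = 0) : fshrV a b c = b := by
  apply BitVec.eq_of_getLsbD_eq
  intro i hi
  rw [getLsbD_fshrV a b c hi, h, Nat.zero_add, if_pos hi]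

/-! ## §'Arithmetic with Overflow Intrinsics' (L16373–16395): the manual's definition of "overflows" -/

/-- "An operation overflows if […] for any ``N`` larger than the operands' width, ``ext(A op B) to iN`` is not equal to ``(ext(A) to iN)
op (ext(B) to iN)`` where ``ext`` is […] ``zext`` for unsigned overflow" — instance `op = add`, at comparison width `N`.
[cite: LLVMLangRef18, §'Arithmetic with Overflow Intrinsics' L16387–16392] -/
def UAddOverflowsAt (N : ℕ) (A B : BitVec w) : Prop := (A + B).setWidth N ≠ A.setWidth N + B.setWidth N

/-- Same sentence, `ext = sext` ("for signed overflow"), `op = add`. [cite: LLVMLangRef18, §'Arithmetic with Overflow Intrinsics' L16387–16392] -/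
def SAddOverflowsAt (N : ℕ) (A B : BitVec w) : Prop := (A + B).signExtend N ≠ A.signExtend N + B.signExtend N

/-- Same sentence, `ext = zext`, `op = sub`. [cite: LLVMLangRef18, §'Arithmetic with Overflow Intrinsics' L16387–16392] -/
def USubOverflowsAt (N : ℕ) (A B : BitVec w) : Prop := (A - B).setWidth N ≠ A.setWidth N - B.setWidth N

/-- Same sentence, `ext = sext`, `op = sub`. [cite: LLVMLangRef18, §'Arithmetic with Overflow Intrinsics' L16387–16392] -/
def SSubOverflowsAt (N : ℕ) (A B : BitVec w) : Prop := (A - B).signExtend N ≠ A.signExtend N - B.signExtend N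

/-- Same sentence, `ext = zext`, `op = mul`. [cite: LLVMLangRef18, §'Arithmetic with Overflow Intrinsics' L16387–16392] -/
def UMulOverflowsAt (N : ℕ) (A B : BitVec w) : Prop := (A * B).setWidth N ≠ A.setWidth N * B.setWidth N

/-- Same sentence, `ext = sext`, `op = mul`. [cite: LLVMLangRef18, §'Arithmetic with Overflow Intrinsics' L16387–16392] -/
def SMulOverflowsAt (N : ℕ) (A B : BitVec w) : Prop := (A * B).signExtend N ≠ A.signExtend N * B.signExtend N

/-- Each `…OverflowsAt` is a decidable comparison of two `N`-bit values. [cite: LLVMLangRef18, §'Arithmetic with Overflow Intrinsics' L16387–16392] -/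
instance instDecidableUAddOverflowsAt (N : ℕ) (A B : BitVec w) : Decidable (UAddOverflowsAt N A B) :=
  inferInstanceAs (Decidable (_ ≠ _))
/-- See `instDecidableUAddOverflowsAt`. [cite: LLVMLangRef18, §'Arithmetic with Overflow Intrinsics' L16387–16392] -/
instance instDecidableSAddOverflowsAt (N : ℕ) (A B : BitVec w) : Decidable (SAddOverflowsAt N A B) :=
  inferInstanceAs (Decidable (_ ≠ _))
/-- See `instDecidableUAddOverflowsAt`. [cite: LLVMLangRef18, §'Arithmetic with Overflow Intrinsics' L16387–16392] -/
instance instDecidableUSubOverflowsAt (N : ℕ) (A B : BitVec w) : Decidable (USubOverflowsAt N A B) :=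
  inferInstanceAs (Decidable (_ ≠ _))
/-- See `instDecidableUAddOverflowsAt`. [cite: LLVMLangRef18, §'Arithmetic with Overflow Intrinsics' L16387–16392] -/
instance instDecidableSSubOverflowsAt (N : ℕ) (A B : BitVec w) : Decidable (SSubOverflowsAt N A B) :=
  inferInstanceAs (Decidable (_ ≠ _))
/-- See `instDecidableUAddOverflowsAt`. [cite: LLVMLangRef18, §'Arithmetic with Overflow Intrinsics' L16387–16392] -/
instance instDecidableUMulOverflowsAt (N : ℕ) (A B : BitVec w) : Decidable (UMulOverflowsAt N A B) :=
  inferInstanceAs (Decidable (_ ≠ _))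
/-- See `instDecidableUAddOverflowsAt`. [cite: LLVMLangRef18, §'Arithmetic with Overflow Intrinsics' L16387–16392] -/
instance instDecidableSMulOverflowsAt (N : ℕ) (A B : BitVec w) : Decidable (SMulOverflowsAt N A B) :=
  inferInstanceAs (Decidable (_ ≠ _))

/-- "An operation overflows if, for any values of its operands ``A`` and ``B`` and for any ``N`` larger than the operands' width, …" — read
EXISTENTIALLY over `N > w` (see the module docstring: for add/sub the choice of `N` is immaterial, for mul it is not, and only this reading
reports `umul.with.overflow.i4(8, 4)` as overflowing); unsigned addition. [cite: LLVMLangRef18, §'Arithmetic with Overflow Intrinsics' L16387–16392] -/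
def UAddOverflows (A B : BitVec w) : Prop := ∃ N, w < N ∧ UAddOverflowsAt N A B
/-- Signed addition overflows (existential reading). [cite: LLVMLangRef18, §'Arithmetic with Overflow Intrinsics' L16387–16392] -/
def SAddOverflows (A B : BitVec w) : Prop := ∃ N, w < N ∧ SAddOverflowsAt N A B
/-- Unsigned subtraction overflows (existential reading). [cite: LLVMLangRef18, §'Arithmetic with Overflow Intrinsics' L16387–16392] -/
def USubOverflows (A B : BitVec w) : Prop := ∃ N, w < N ∧ USubOverflowsAt N A B
/-- Signed subtraction overflows (existential reading). [cite: LLVMLangRef18, §'Arithmetic with Overflow Intrinsics' L16387–16392] -/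
def SSubOverflows (A B : BitVec w) : Prop := ∃ N, w < N ∧ SSubOverflowsAt N A B
/-- Unsigned multiplication overflows (existential reading). [cite: LLVMLangRef18, §'Arithmetic with Overflow Intrinsics' L16387–16392] -/
def UMulOverflows (A B : BitVec w) : Prop := ∃ N, w < N ∧ UMulOverflowsAt N A B
/-- Signed multiplication overflows (existential reading). [cite: LLVMLangRef18, §'Arithmetic with Overflow Intrinsics' L16387–16392] -/
def SMulOverflows (A B : BitVec w) : Prop := ∃ N, w < N ∧ SMulOverflowsAt N A B

/-- Core of the unsigned cases: a `w`-bit value `R` that is the exact natural number `s` reduced modulo `2^w`, compared after zero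
extension with an `N`-bit value holding `s` exactly (`w ≤ N`), differs from it iff `s` did not fit in `w` bits.
[cite: LLVMLangRef18, §'Arithmetic with Overflow Intrinsics' L16387–16392] -/
theorem setWidth_ne_iff_of_toNat_eq {N : ℕ} (hwN : w ≤ N) (R : BitVec w) (T : BitVec N) (s : ℕ) (hR : R.toNat = s % 2 ^ w)
    (hT : T.toNat = s) : R.setWidth N ≠ T ↔ 2 ^ w ≤ s := by
  have hpow : 2 ^ w ≤ 2 ^ N := Nat.pow_le_pow_right (by norm_num) hwN
  have hlt : s % 2 ^ w < 2 ^ w := Nat.mod_lt _ (by positivity)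
  rw [ne_eq, BitVec.toNat_eq, BitVec.toNat_setWidth, hR, hT, Nat.mod_eq_of_lt (by omega : s % 2 ^ w < 2 ^ N)]
  constructor
  · intro h
    by_contra hs
    exact h (Nat.mod_eq_of_lt (by omega))
  · intro h heq
    omega

/-- Core of the signed cases: a `w`-bit value `R` (`0 < w`) whose two's-complement integer is the exact integer `s` reduced by `bmod 2^w`,
compared after sign extension with an `N`-bit value holding `s` exactly (`w ≤ N`), differs from it iff `s` lies outside
`[-2^(w-1), 2^(w-1))`. [cite: LLVMLangRef18, §'Arithmetic with Overflow Intrinsics' L16387–16392] -/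
theorem signExtend_ne_iff_of_toInt_eq {N : ℕ} (hw : 0 < w) (hwN : w ≤ N) (R : BitVec w) (T : BitVec N) (s : ℤ)
    (hR : R.toInt = s.bmod (2 ^ w)) (hT : T.toInt = s) :
    R.signExtend N ≠ T ↔ (s < -2 ^ (w - 1) ∨ 2 ^ (w - 1) ≤ s) := by
  rw [← BitVec.toInt_ne, BitVec.toInt_signExtend_of_le hwN, hT]
  have hr1 := BitVec.le_toInt R
  have hr2 := @BitVec.toInt_lt w R
  constructor
  · intro hne
    by_contra hin
    push Not at hin
    apply hne
    rw [hR, ← BitVec.toInt_ofInt]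
    exact BitVec.toInt_ofInt_eq_self hw hin.1 hin.2
  · rintro (h | h) heq <;> linarith

/-- Bounds used repeatedly: a `w`-bit two's-complement integer lies in `[-2^(w-1), 2^(w-1))`, and `2 · 2^(w-1) = 2^w ≤ 2^(N-1)` once
`0 < w < N`. [cite: LLVMLangRef18, §'Arithmetic with Overflow Intrinsics' L16387–16392] -/
theorem two_mul_two_pow_pred_le {N : ℕ} (hw : 0 < w) (hwN : w < N) : (2 : ℤ) ^ (w - 1) * 2 ≤ 2 ^ (N - 1) := by
  rw [← pow_succ, show w - 1 + 1 = w by omega]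
  exact pow_le_pow_right₀ (by norm_num) (by omega)

/-- `uadd`: at ANY comparison width `N > w`, the manual's inequality holds iff the exact sum is `≥ 2^w`, i.e. iff Lean core's
`BitVec.uaddOverflow` (the predicate `BinaryOperators.addV`/`uaddWithOverflowV` use) is `true`.
[cite: LLVMLangRef18, §'Arithmetic with Overflow Intrinsics' L16387–16392; §'llvm.uadd.with.overflow.*' L16483–16486] -/
theorem uaddOverflowsAt_iff {N : ℕ} (hN : w < N) (A B : BitVec w) :
    UAddOverflowsAt N A B ↔ 2 ^ w ≤ A.toNat + B.toNat := by
  have hA := A.isLt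
  have hB := B.isLt
  have hpow : 2 * 2 ^ w ≤ 2 ^ N := by
    rw [← pow_succ']
    exact Nat.pow_le_pow_right (by norm_num) hN
  refine setWidth_ne_iff_of_toNat_eq hN.le (A + B) (A.setWidth N + B.setWidth N) (A.toNat + B.toNat) (BitVec.toNat_add A B) ?_
  rw [BitVec.toNat_add, BitVec.toNat_setWidth, BitVec.toNat_setWidth, Nat.mod_eq_of_lt (by omega : A.toNat < 2 ^ N),
    Nat.mod_eq_of_lt (by omega : B.toNat < 2 ^ N), Nat.mod_eq_of_lt (by omega)]

/-- `usub`: at any `N > w`, the manual's inequality holds iff the exact difference is negative (`A < B` unsigned), i.e. iff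
`BitVec.usubOverflow`. [cite: LLVMLangRef18, §'Arithmetic with Overflow Intrinsics' L16387–16392; §'llvm.usub.with.overflow.*' L16584–16588] -/
theorem usubOverflowsAt_iff {N : ℕ} (hN : w < N) (A B : BitVec w) :
    USubOverflowsAt N A B ↔ A.toNat < B.toNat := by
  have hA := A.isLt
  have hB := B.isLt
  have hpow : 2 * 2 ^ w ≤ 2 ^ N := by
    rw [← pow_succ']
    exact Nat.pow_le_pow_right (by norm_num) hN
  have hw0 : 0 < 2 ^ w := by positivity
  -- `(2^n - b + a) % 2^n` is `a - b` without borrow and `2^n - b + a` with borrow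
  have key : ∀ (n a b : ℕ), a < 2 ^ n → b < 2 ^ n →
      (2 ^ n - b + a) % 2 ^ n = if b ≤ a then a - b else 2 ^ n - b + a := by
    intro n a b ha hb
    split_ifs with hle
    · rw [show 2 ^ n - b + a = (a - b) + 2 ^ n by omega, Nat.add_mod_right, Nat.mod_eq_of_lt (by omega)]
    · exact Nat.mod_eq_of_lt (by omega)
  unfold USubOverflowsAt
  rw [ne_eq, BitVec.toNat_eq, BitVec.toNat_setWidth, BitVec.toNat_sub, BitVec.toNat_sub, BitVec.toNat_setWidth,
    BitVec.toNat_setWidth, Nat.mod_eq_of_lt (by omega : A.toNat < 2 ^ N), Nat.mod_eq_of_lt (by omega : B.toNat < 2 ^ N),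
    key w A.toNat B.toNat hA hB, key N A.toNat B.toNat (by omega) (by omega)]
  have hsmall : (if B.toNat ≤ A.toNat then A.toNat - B.toNat else 2 ^ w - B.toNat + A.toNat) < 2 ^ N := by
    split_ifs <;> omega
  rw [Nat.mod_eq_of_lt hsmall]
  constructor
  · intro h
    by_contra hlt
    rw [if_pos (by omega), if_pos (by omega)] at h
    exact h rfl
  · intro h
    rw [if_neg (by omega), if_neg (by omega)]
    omega

/-- `sadd`: at any `N > w`, the manual's inequality holds iff the exact signed sum leaves `[-2^(w-1), 2^(w-1))`, i.e. iff
`BitVec.saddOverflow`. [cite: LLVMLangRef18, §'Arithmetic with Overflow Intrinsics' L16387–16392; §'llvm.sadd.with.overflow.*' L16432–16436] -/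
theorem saddOverflowsAt_iff {N : ℕ} (hN : w < N) (A B : BitVec w) :
    SAddOverflowsAt N A B ↔ (A.toInt + B.toInt < -2 ^ (w - 1) ∨ 2 ^ (w - 1) ≤ A.toInt + B.toInt) := by
  rcases Nat.eq_zero_or_pos w with rfl | hw
  · -- width 0: both operands are the empty bit-vector, nothing overflows and nothing differs
    have hA : A.toInt = 0 := by simp [BitVec.toInt_zero_length]
    have hB : B.toInt = 0 := by simp [BitVec.toInt_zero_length]
    unfold SAddOverflowsAt
    rw [← BitVec.toInt_ne, BitVec.toInt_signExtend_of_le (by omega), BitVec.toInt_add, BitVec.toInt_add,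
      BitVec.toInt_signExtend_of_le (by omega), BitVec.toInt_signExtend_of_le (by omega), hA, hB]
    norm_num
  have hA1 := BitVec.le_toInt A
  have hA2 := @BitVec.toInt_lt w A
  have hB1 := BitVec.le_toInt B
  have hB2 := @BitVec.toInt_lt w B
  have hp := two_mul_two_pow_pred_le hw hN
  refine signExtend_ne_iff_of_toInt_eq hw hN.le (A + B) _ (A.toInt + B.toInt) (BitVec.toInt_add A B) ?_
  simp only [BitVec.signExtend]
  rw [← BitVec.ofInt_add]
  exact BitVec.toInt_ofInt_eq_self (by omega) (by linarith) (by linarith)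

/-- `ssub`: at any `N > w`, the manual's inequality holds iff the exact signed difference leaves `[-2^(w-1), 2^(w-1))`, i.e. iff
`BitVec.ssubOverflow`. [cite: LLVMLangRef18, §'Arithmetic with Overflow Intrinsics' L16387–16392; §'llvm.ssub.with.overflow.*' L16533–16537] -/
theorem ssubOverflowsAt_iff {N : ℕ} (hN : w < N) (A B : BitVec w) :
    SSubOverflowsAt N A B ↔ (A.toInt - B.toInt < -2 ^ (w - 1) ∨ 2 ^ (w - 1) ≤ A.toInt - B.toInt) := by
  rcases Nat.eq_zero_or_pos w with rfl | hw
  · have hA : A.toInt = 0 := by simp [BitVec.toInt_zero_length]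
    have hB : B.toInt = 0 := by simp [BitVec.toInt_zero_length]
    unfold SSubOverflowsAt
    rw [← BitVec.toInt_ne, BitVec.toInt_signExtend_of_le (by omega), BitVec.toInt_sub, BitVec.toInt_sub,
      BitVec.toInt_signExtend_of_le (by omega), BitVec.toInt_signExtend_of_le (by omega), hA, hB]
    norm_num
  have hA1 := BitVec.le_toInt A
  have hA2 := @BitVec.toInt_lt w A
  have hB1 := BitVec.le_toInt B
  have hB2 := @BitVec.toInt_lt w B
  have hp := two_mul_two_pow_pred_le hw hN
  refine signExtend_ne_iff_of_toInt_eq hw hN.le (A - B) _ (A.toInt - B.toInt) BitVec.toInt_sub ?_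
  simp only [BitVec.signExtend]
  rw [sub_eq_add_neg (BitVec.ofInt N A.toInt), ← BitVec.ofInt_neg, ← BitVec.ofInt_add, ← sub_eq_add_neg]
  exact BitVec.toInt_ofInt_eq_self (by omega) (by linarith) (by linarith)

/-- `umul`: at every comparison width `N ≥ 2w` (wide enough to hold the exact product) the manual's inequality holds iff the exact product
is `≥ 2^w`, i.e. iff `BitVec.umulOverflow`. [cite: LLVMLangRef18, §'Arithmetic with Overflow Intrinsics' L16387–16392;
§'llvm.umul.with.overflow.*' L16686–16690] -/
theorem umulOverflowsAt_iff {N : ℕ} (hN : 2 * w ≤ N) (A B : BitVec w) :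
    UMulOverflowsAt N A B ↔ 2 ^ w ≤ A.toNat * B.toNat := by
  have hA := A.isLt
  have hB := B.isLt
  have hprod : A.toNat * B.toNat < 2 ^ N := by
    calc A.toNat * B.toNat < 2 ^ w * 2 ^ w := Nat.mul_lt_mul'' hA hB
      _ = 2 ^ (2 * w) := by rw [two_mul, pow_add]
      _ ≤ 2 ^ N := Nat.pow_le_pow_right (by norm_num) hN
  have hAN : A.toNat < 2 ^ N := lt_of_lt_of_le hA (Nat.pow_le_pow_right (by norm_num) (by omega))
  have hBN : B.toNat < 2 ^ N := lt_of_lt_of_le hB (Nat.pow_le_pow_right (by norm_num) (by omega))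
  refine setWidth_ne_iff_of_toNat_eq (by omega) (A * B) (A.setWidth N * B.setWidth N) (A.toNat * B.toNat) (BitVec.toNat_mul A B) ?_
  rw [BitVec.toNat_mul, BitVec.toNat_setWidth, BitVec.toNat_setWidth, Nat.mod_eq_of_lt hAN, Nat.mod_eq_of_lt hBN,
    Nat.mod_eq_of_lt hprod]

/-- `smul`: at every `N ≥ 2w` the manual's inequality holds iff the exact signed product leaves `[-2^(w-1), 2^(w-1))`, i.e. iff
`BitVec.smulOverflow`. [cite: LLVMLangRef18, §'Arithmetic with Overflow Intrinsics' L16387–16392; §'llvm.smul.with.overflow.*' L16635–16639] -/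
theorem smulOverflowsAt_iff {N : ℕ} (hw : 0 < w) (hN : 2 * w ≤ N) (A B : BitVec w) :
    SMulOverflowsAt N A B ↔ (A.toInt * B.toInt < -2 ^ (w - 1) ∨ 2 ^ (w - 1) ≤ A.toInt * B.toInt) := by
  have hA1 := BitVec.le_toInt A
  have hA2 := @BitVec.toInt_lt w A
  have hB1 := BitVec.le_toInt B
  have hB2 := @BitVec.toInt_lt w B
  -- |a·b| ≤ 2^(w-1)·2^(w-1) < 2^(N-1)
  have habs : |A.toInt * B.toInt| ≤ 2 ^ (w - 1) * 2 ^ (w - 1) := by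
    rw [abs_mul]
    exact mul_le_mul (abs_le.mpr ⟨by linarith, by linarith⟩) (abs_le.mpr ⟨by linarith, by linarith⟩) (abs_nonneg _)
      (by positivity)
  have hlt : (2 : ℤ) ^ (w - 1) * 2 ^ (w - 1) < 2 ^ (N - 1) := by
    rw [← pow_add]
    exact pow_lt_pow_right₀ (by norm_num) (by omega)
  have hb := abs_le.mp habs
  refine signExtend_ne_iff_of_toInt_eq hw (by omega) (A * B) _ (A.toInt * B.toInt) (BitVec.toInt_mul A B) ?_
  simp only [BitVec.signExtend]
  rw [← BitVec.ofInt_mul]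
  exact BitVec.toInt_ofInt_eq_self (by omega) (by linarith) (by linarith)

/-- For `umul` the comparison width MATTERS: the `i4` operands `8` and `4` (exact product `32`, which overflows `i4`) give EQUAL zero
extensions of `A·B mod 16 = 0` and of `zext(A)·zext(B) mod 2^N` at `N = 5` (`32 mod 32 = 0`) but unequal ones at `N = 6`.  So "for any
``N`` larger than the operands' width" cannot be read as "for every such N" (that reading would call this product non-overflowing); the
existential reading `UMulOverflows` reports it. [cite: LLVMLangRef18, §'Arithmetic with Overflow Intrinsics' L16387–16392] -/
theorem umulOverflowsAt_depends_on_N :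
    ¬UMulOverflowsAt 5 (8#4) (4#4) ∧ UMulOverflowsAt 6 (8#4) (4#4) ∧ UMulOverflowsAt 8 (8#4) (4#4) := by
  decide

/-- For the four add/sub intrinsics the width does not matter: the printed condition at SOME `N > w` is the condition at EVERY `N > w`.
[cite: LLVMLangRef18, §'Arithmetic with Overflow Intrinsics' L16387–16392] -/
theorem uaddOverflows_iff_forall (A B : BitVec w) : UAddOverflows A B ↔ ∀ N, w < N → UAddOverflowsAt N A B := by
  constructor
  · rintro ⟨N, hN, h⟩ M hM
    exact (uaddOverflowsAt_iff hM A B).mpr ((uaddOverflowsAt_iff hN A B).mp h)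
  · intro h
    exact ⟨w + 1, by omega, h (w + 1) (by omega)⟩

/-- See `uaddOverflows_iff_forall`. [cite: LLVMLangRef18, §'Arithmetic with Overflow Intrinsics' L16387–16392] -/
theorem usubOverflows_iff_forall (A B : BitVec w) : USubOverflows A B ↔ ∀ N, w < N → USubOverflowsAt N A B := by
  constructor
  · rintro ⟨N, hN, h⟩ M hM
    exact (usubOverflowsAt_iff hM A B).mpr ((usubOverflowsAt_iff hN A B).mp h)
  · intro h
    exact ⟨w + 1, by omega, h (w + 1) (by omega)⟩

/-- See `uaddOverflows_iff_forall`. [cite: LLVMLangRef18, §'Arithmetic with Overflow Intrinsics' L16387–16392] -/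
theorem saddOverflows_iff_forall (A B : BitVec w) : SAddOverflows A B ↔ ∀ N, w < N → SAddOverflowsAt N A B := by
  constructor
  · rintro ⟨N, hN, h⟩ M hM
    exact (saddOverflowsAt_iff hM A B).mpr ((saddOverflowsAt_iff hN A B).mp h)
  · intro h
    exact ⟨w + 1, by omega, h (w + 1) (by omega)⟩

/-- See `uaddOverflows_iff_forall`. [cite: LLVMLangRef18, §'Arithmetic with Overflow Intrinsics' L16387–16392] -/
theorem ssubOverflows_iff_forall (A B : BitVec w) : SSubOverflows A B ↔ ∀ N, w < N → SSubOverflowsAt N A B := by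
  constructor
  · rintro ⟨N, hN, h⟩ M hM
    exact (ssubOverflowsAt_iff hM A B).mpr ((ssubOverflowsAt_iff hN A B).mp h)
  · intro h
    exact ⟨w + 1, by omega, h (w + 1) (by omega)⟩

/-- The manual's "overflows" for `uadd.with.overflow` IS Lean core's `BitVec.uaddOverflow` — the predicate `BinaryOperators.lean` used
for the words "unsigned overflow". [cite: LLVMLangRef18, §'Arithmetic with Overflow Intrinsics' L16387–16392; §'llvm.uadd.with.overflow.*'
L16483–16486] -/
theorem uaddOverflows_iff (A B : BitVec w) : UAddOverflows A B ↔ BitVec.uaddOverflow A B = true := by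
  rw [BitVec.uaddOverflow, decide_eq_true_eq]
  constructor
  · rintro ⟨N, hN, h⟩
    exact (uaddOverflowsAt_iff hN A B).mp h
  · intro h
    exact ⟨w + 1, by omega, (uaddOverflowsAt_iff (by omega) A B).mpr h⟩

/-- `usub`: the manual's "overflows" IS `BitVec.usubOverflow`. [cite: LLVMLangRef18, §'Arithmetic with Overflow Intrinsics'
L16387–16392; §'llvm.usub.with.overflow.*' L16584–16588] -/
theorem usubOverflows_iff (A B : BitVec w) : USubOverflows A B ↔ BitVec.usubOverflow A B = true := by
  rw [BitVec.usubOverflow, decide_eq_true_eq]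
  constructor
  · rintro ⟨N, hN, h⟩
    exact (usubOverflowsAt_iff hN A B).mp h
  · intro h
    exact ⟨w + 1, by omega, (usubOverflowsAt_iff (by omega) A B).mpr h⟩

/-- `sadd`: the manual's "overflows" IS `BitVec.saddOverflow`. [cite: LLVMLangRef18, §'Arithmetic with Overflow Intrinsics'
L16387–16392; §'llvm.sadd.with.overflow.*' L16432–16436] -/
theorem saddOverflows_iff (A B : BitVec w) : SAddOverflows A B ↔ BitVec.saddOverflow A B = true := by
  have key : SAddOverflows A B ↔ (A.toInt + B.toInt < -2 ^ (w - 1) ∨ 2 ^ (w - 1) ≤ A.toInt + B.toInt) := by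
    constructor
    · rintro ⟨N, hN, h⟩
      exact (saddOverflowsAt_iff hN A B).mp h
    · intro h
      exact ⟨w + 1, by omega, (saddOverflowsAt_iff (by omega) A B).mpr h⟩
  rw [key, BitVec.saddOverflow]
  simp only [Bool.or_eq_true, decide_eq_true_eq, ge_iff_le]
  tauto

/-- `ssub`: the manual's "overflows" IS `BitVec.ssubOverflow`. [cite: LLVMLangRef18, §'Arithmetic with Overflow Intrinsics'
L16387–16392; §'llvm.ssub.with.overflow.*' L16533–16537] -/
theorem ssubOverflows_iff (A B : BitVec w) : SSubOverflows A B ↔ BitVec.ssubOverflow A B = true := by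
  have key : SSubOverflows A B ↔ (A.toInt - B.toInt < -2 ^ (w - 1) ∨ 2 ^ (w - 1) ≤ A.toInt - B.toInt) := by
    constructor
    · rintro ⟨N, hN, h⟩
      exact (ssubOverflowsAt_iff hN A B).mp h
    · intro h
      exact ⟨w + 1, by omega, (ssubOverflowsAt_iff (by omega) A B).mpr h⟩
  rw [key, BitVec.ssubOverflow]
  simp only [Bool.or_eq_true, decide_eq_true_eq, ge_iff_le]
  tauto

/-- `umul`: the manual's "overflows" (existential reading) IS `BitVec.umulOverflow`. [cite: LLVMLangRef18, §'Arithmetic with Overflow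
Intrinsics' L16387–16392; §'llvm.umul.with.overflow.*' L16686–16690] -/
theorem umulOverflows_iff (A B : BitVec w) : UMulOverflows A B ↔ BitVec.umulOverflow A B = true := by
  rw [BitVec.umulOverflow, decide_eq_true_eq]
  constructor
  · rintro ⟨N, hN, h⟩
    -- if the product fitted in `w` bits, both sides would be that product at every `N > w`
    by_contra hlt
    push Not at hlt
    have hA := A.isLt
    have hB := B.isLt
    have hpow : 2 ^ w < 2 ^ N := Nat.pow_lt_pow_right (by norm_num) hN
    have hAN : A.toNat < 2 ^ N := by omega
    have hBN : B.toNat < 2 ^ N := by omega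
    apply h
    apply BitVec.eq_of_toNat_eq
    rw [BitVec.toNat_setWidth, BitVec.toNat_mul, BitVec.toNat_mul, BitVec.toNat_setWidth, BitVec.toNat_setWidth,
      Nat.mod_eq_of_lt hAN, Nat.mod_eq_of_lt hBN, Nat.mod_eq_of_lt hlt, Nat.mod_eq_of_lt (by omega : A.toNat * B.toNat < 2 ^ N)]
  · intro h
    exact ⟨2 * w + 1, by omega, (umulOverflowsAt_iff (by omega) A B).mpr h⟩

/-- `smul`: the manual's "overflows" (existential reading) IS `BitVec.smulOverflow`. [cite: LLVMLangRef18, §'Arithmetic with Overflow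
Intrinsics' L16387–16392; §'llvm.smul.with.overflow.*' L16635–16639] -/
theorem smulOverflows_iff (A B : BitVec w) : SMulOverflows A B ↔ BitVec.smulOverflow A B = true := by
  rcases Nat.eq_zero_or_pos w with rfl | hw
  · -- width 0: no `N` makes the (zero) extensions differ, and the core predicate is `false`
    have hA : A.toInt = 0 := by simp [BitVec.toInt_zero_length]
    have hB : B.toInt = 0 := by simp [BitVec.toInt_zero_length]
    have hno : ∀ N, ¬SMulOverflowsAt N A B := by
      intro N h
      apply h
      apply BitVec.eq_of_toInt_eq
      rw [BitVec.toInt_signExtend_of_le (by omega), BitVec.toInt_mul, BitVec.toInt_mul,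
        BitVec.toInt_signExtend_of_le (by omega), BitVec.toInt_signExtend_of_le (by omega), hA, hB]
      norm_num
    simp only [SMulOverflows, BitVec.smulOverflow, hA, hB]
    norm_num
    exact fun N _ => hno N
  have key : SMulOverflows A B ↔ (A.toInt * B.toInt < -2 ^ (w - 1) ∨ 2 ^ (w - 1) ≤ A.toInt * B.toInt) := by
    constructor
    · rintro ⟨N, hN, h⟩
      -- if the product fitted, both sides would be that product at every `N > w`
      by_contra hin
      push Not at hin
      have hA1 := BitVec.le_toInt A
      have hA2 := @BitVec.toInt_lt w A
      have hB1 := BitVec.le_toInt B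
      have hB2 := @BitVec.toInt_lt w B
      have hp := two_mul_two_pow_pred_le hw hN
      have hfit : (A * B).toInt = A.toInt * B.toInt := by
        rw [BitVec.toInt_mul, ← BitVec.toInt_ofInt]
        exact BitVec.toInt_ofInt_eq_self hw hin.1 hin.2
      apply h
      apply BitVec.eq_of_toInt_eq
      rw [BitVec.toInt_signExtend_of_le (by omega), hfit]
      simp only [BitVec.signExtend]
      rw [← BitVec.ofInt_mul, BitVec.toInt_ofInt_eq_self (by omega) (by linarith) (by linarith)]
    · intro h
      exact ⟨2 * w, by omega, (smulOverflowsAt_iff hw le_rfl A B).mpr h⟩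
  rw [key, BitVec.smulOverflow]
  simp only [Bool.or_eq_true, decide_eq_true_eq, ge_iff_le]
  tauto

/-- "overflows" is decidable — by the proved characterisations (the existential over `N` is not itself a finite check).
[cite: LLVMLangRef18, §'Arithmetic with Overflow Intrinsics' L16387–16392] -/
instance instDecidableUAddOverflows (A B : BitVec w) : Decidable (UAddOverflows A B) :=
  decidable_of_iff _ (uaddOverflows_iff A B).symm
/-- See `instDecidableUAddOverflows`. [cite: LLVMLangRef18, §'Arithmetic with Overflow Intrinsics' L16387–16392] -/
instance instDecidableUSubOverflows (A B : BitVec w) : Decidable (USubOverflows A B) :=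
  decidable_of_iff _ (usubOverflows_iff A B).symm
/-- See `instDecidableUAddOverflows`. [cite: LLVMLangRef18, §'Arithmetic with Overflow Intrinsics' L16387–16392] -/
instance instDecidableSAddOverflows (A B : BitVec w) : Decidable (SAddOverflows A B) :=
  decidable_of_iff _ (saddOverflows_iff A B).symm
/-- See `instDecidableUAddOverflows`. [cite: LLVMLangRef18, §'Arithmetic with Overflow Intrinsics' L16387–16392] -/
instance instDecidableSSubOverflows (A B : BitVec w) : Decidable (SSubOverflows A B) :=
  decidable_of_iff _ (ssubOverflows_iff A B).symm
/-- See `instDecidableUAddOverflows`. [cite: LLVMLangRef18, §'Arithmetic with Overflow Intrinsics' L16387–16392] -/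
instance instDecidableUMulOverflows (A B : BitVec w) : Decidable (UMulOverflows A B) :=
  decidable_of_iff _ (umulOverflows_iff A B).symm
/-- See `instDecidableUAddOverflows`. [cite: LLVMLangRef18, §'Arithmetic with Overflow Intrinsics' L16387–16392] -/
instance instDecidableSMulOverflows (A B : BitVec w) : Decidable (SMulOverflows A B) :=
  decidable_of_iff _ (smulOverflows_iff A B).symm

/-- With these instances the `i4` example of `umulOverflowsAt_depends_on_N` evaluates: `umul.with.overflow.i4(8, 4)` overflows, and so
does the printed `uadd.sat`-style carry `uadd.i4(8, 8)`; `uadd.i4(5, 6)` does not. [cite: LLVMLangRef18, §'Arithmetic with Overflow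
Intrinsics' L16386–16392] -/
theorem overflows_examples : UMulOverflows (8#4) (4#4) ∧ UAddOverflows (8#4) (8#4) ∧ ¬UAddOverflows (5#4) (6#4) ∧
    SMulOverflows (4#4) (2#4) ∧ ¬SMulOverflows (-4#4) (2#4) ∧ USubOverflows (1#4) (2#4) ∧ SSubOverflows (-8#4) (1#4) := by
  decide

/-- Hence the second element of the typed `uadd.with.overflow` struct of `BinaryOperators.lean` is `1` exactly when the operation
"overflows" in the manual's own sense: "The second element of the result is an ``i1`` that is 1 if the arithmetic operation overflowed and
0 otherwise." [cite: LLVMLangRef18, §'Arithmetic with Overflow Intrinsics' L16386–16392] -/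
theorem uaddWithOverflowV_snd (x y : BitVec w) : (uaddWithOverflowV x y).2 = decide (UAddOverflows x y) := by
  rw [show (uaddWithOverflowV x y).2 = BitVec.uaddOverflow x y from rfl]
  by_cases h : UAddOverflows x y
  · rw [decide_eq_true h, (uaddOverflows_iff x y).mp h]
  · rw [decide_eq_false h, Bool.eq_false_iff]
    exact fun h' => h ((uaddOverflows_iff x y).mpr h')

/-- Same for `usub.with.overflow`. [cite: LLVMLangRef18, §'Arithmetic with Overflow Intrinsics' L16386–16392] -/
theorem usubWithOverflowV_snd (x y : BitVec w) : (usubWithOverflowV x y).2 = decide (USubOverflows x y) := by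
  rw [show (usubWithOverflowV x y).2 = BitVec.usubOverflow x y from rfl]
  by_cases h : USubOverflows x y
  · rw [decide_eq_true h, (usubOverflows_iff x y).mp h]
  · rw [decide_eq_false h, Bool.eq_false_iff]
    exact fun h' => h ((usubOverflows_iff x y).mpr h')

/-- Same for `sadd.with.overflow`. [cite: LLVMLangRef18, §'Arithmetic with Overflow Intrinsics' L16386–16392] -/
theorem saddWithOverflowV_snd (x y : BitVec w) : (saddWithOverflowV x y).2 = decide (SAddOverflows x y) := by
  rw [show (saddWithOverflowV x y).2 = BitVec.saddOverflow x y from rfl]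
  by_cases h : SAddOverflows x y
  · rw [decide_eq_true h, (saddOverflows_iff x y).mp h]
  · rw [decide_eq_false h, Bool.eq_false_iff]
    exact fun h' => h ((saddOverflows_iff x y).mpr h')

/-- Same for `ssub.with.overflow`. [cite: LLVMLangRef18, §'Arithmetic with Overflow Intrinsics' L16386–16392] -/
theorem ssubWithOverflowV_snd (x y : BitVec w) : (ssubWithOverflowV x y).2 = decide (SSubOverflows x y) := by
  rw [show (ssubWithOverflowV x y).2 = BitVec.ssubOverflow x y from rfl]
  by_cases h : SSubOverflows x y
  · rw [decide_eq_true h, (ssubOverflows_iff x y).mp h]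
  · rw [decide_eq_false h, Bool.eq_false_iff]
    exact fun h' => h ((ssubOverflows_iff x y).mpr h')

/-- Same for `umul.with.overflow`. [cite: LLVMLangRef18, §'Arithmetic with Overflow Intrinsics' L16386–16392] -/
theorem umulWithOverflowV_snd (x y : BitVec w) : (umulWithOverflowV x y).2 = decide (UMulOverflows x y) := by
  rw [show (umulWithOverflowV x y).2 = BitVec.umulOverflow x y from rfl]
  by_cases h : UMulOverflows x y
  · rw [decide_eq_true h, (umulOverflows_iff x y).mp h]
  · rw [decide_eq_false h, Bool.eq_false_iff]
    exact fun h' => h ((umulOverflows_iff x y).mpr h')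

/-- Same for `smul.with.overflow`. [cite: LLVMLangRef18, §'Arithmetic with Overflow Intrinsics' L16386–16392] -/
theorem smulWithOverflowV_snd (x y : BitVec w) : (smulWithOverflowV x y).2 = decide (SMulOverflows x y) := by
  rw [show (smulWithOverflowV x y).2 = BitVec.smulOverflow x y from rfl]
  by_cases h : SMulOverflows x y
  · rw [decide_eq_true h, (smulOverflows_iff x y).mp h]
  · rw [decide_eq_false h, Bool.eq_false_iff]
    exact fun h' => h ((smulOverflows_iff x y).mpr h')

/-- "The first element of this struct contains the result of the corresponding arithmetic operation modulo 2^n […] always the same as the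
result of a 32-bit ``add`` instruction with the same operands, where the ``add`` is *not* modified by an ``nsw`` or ``nuw`` flag" — for the
typed structs: the first element is the flag-free `addV`/`subV`/`mulV` value. [cite: LLVMLangRef18, §'Arithmetic with Overflow Intrinsics'
L16378–16384] -/
theorem withOverflowV_fst (x y : BitVec w) :
    some (uaddWithOverflowV x y).1 = addV false false x y ∧ some (saddWithOverflowV x y).1 = addV false false x y ∧
      some (usubWithOverflowV x y).1 = subV false false x y ∧ some (ssubWithOverflowV x y).1 = subV false false x y ∧
      some (umulWithOverflowV x y).1 = mulV false false x y ∧ some (smulWithOverflowV x y).1 = mulV false false x y := by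
  simp [uaddWithOverflowV, saddWithOverflowV, usubWithOverflowV, ssubWithOverflowV, umulWithOverflowV, smulWithOverflowV, addV, subV,
    mulV]

/-! ## `llvm.sshl.sat` / `llvm.ushl.sat` (§'llvm.sshl.sat.*' L16902–16952, §'llvm.ushl.sat.*' L16955–17001) -/

/-- `llvm.sshl.sat(a, b)` on defined operands: "If ``b`` is (statically or dynamically) equal to or larger than the integer bit width of the
arguments, the result is a poison value"; otherwise the exact value `a · 2^b` clamped to "the largest signed value representable by the bit
width" above and "the smallest signed value representable by this bit width" below (§'Saturation Arithmetic Intrinsics' L16705–16709: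
"If the result of an operation is greater than the maximum value, the result is set (or "clamped") to this maximum. If it is below the
minimum, it is clamped to this minimum."), else the (then exact) shifted value.
[cite: LLVMLangRef18, §'llvm.sshl.sat.*' L16921–16922, L16928–16931, L16939–16941; §'Saturation Arithmetic Intrinsics' L16705–16709] -/
def sshlSatV (a b : BitVec w) : IVal w :=
  if w ≤ b.toNat then IVal.poison
  else some (if a.toInt * 2 ^ b.toNat < -((2 ^ (w - 1) : ℕ) : ℤ) then BitVec.intMin w
    else if ((2 ^ (w - 1) : ℕ) : ℤ) ≤ a.toInt * 2 ^ b.toNat then BitVec.intMax w else a <<< b)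

/-- `llvm.ushl.sat(a, b)` on defined operands: poison when `b ≥ w`; otherwise `a · 2^b` clamped to "the largest unsigned value representable
by the bit width of the arguments", else the (then exact) shifted value.
[cite: LLVMLangRef18, §'llvm.ushl.sat.*' L16974–16975, L16981–16984, L16991–16992; §'Saturation Arithmetic Intrinsics' L16705–16709] -/
def ushlSatV (a b : BitVec w) : IVal w :=
  if w ≤ b.toNat then IVal.poison
  else some (if 2 ^ w ≤ a.toNat * 2 ^ b.toNat then BitVec.allOnes w else a <<< b)

/-- `llvm.sshl.sat` on `⟦iw⟧` (poison-strict). [cite: LLVMLangRef18, §'llvm.sshl.sat.*' L16928–16941; §'Poison Values' L4553–4554] -/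
def sshlSat (a b : IVal w) : IVal w := IVal.strict₂ sshlSatV a b

/-- `llvm.ushl.sat` on `⟦iw⟧` (poison-strict). [cite: LLVMLangRef18, §'llvm.ushl.sat.*' L16981–16992; §'Poison Values' L4553–4554] -/
def ushlSat (a b : IVal w) : IVal w := IVal.strict₂ ushlSatV a b

/-- The four printed `i4` examples of `sshl.sat`: `(2, 1) = 4`, `(2, 2) = 7`, `(-5, 1) = -8`, `(-1, 1) = -2`.
[cite: LLVMLangRef18, §'llvm.sshl.sat.*' L16949–16952] -/
theorem sshlSatV_examples :
    sshlSatV (2#4) (1#4) = some (4#4) ∧ sshlSatV (2#4) (2#4) = some (7#4) ∧ sshlSatV (-5#4) (1#4) = some (-8#4) ∧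
      sshlSatV (-1#4) (1#4) = some (-2#4) := by
  decide

/-- The two printed `i4` examples of `ushl.sat`: `(2, 1) = 4`, `(3, 3) = 15`. [cite: LLVMLangRef18, §'llvm.ushl.sat.*' L17000–17001] -/
theorem ushlSatV_examples : ushlSatV (2#4) (1#4) = some (4#4) ∧ ushlSatV (3#4) (3#4) = some (15#4) := by
  decide

/-- "If ``b`` is […] equal to or larger than the integer bit width of the arguments, the result is a poison value" (both intrinsics).
[cite: LLVMLangRef18, §'llvm.sshl.sat.*' L16929–16931; §'llvm.ushl.sat.*' L16982–16984] -/
theorem shlSatV_poison_of_le (a b : BitVec w) (h : w ≤ b.toNat) : sshlSatV a b = IVal.poison ∧ ushlSatV a b = IVal.poison := by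
  simp [sshlSatV, ushlSatV, h]

/-- Below the width the saturating shifts never produce poison (only the amount clause creates poison).
[cite: LLVMLangRef18, §'llvm.sshl.sat.*' L16928–16941; §'llvm.ushl.sat.*' L16981–16992] -/
theorem shlSatV_ne_poison_of_lt (a b : BitVec w) (h : b.toNat < w) : sshlSatV a b ≠ IVal.poison ∧ ushlSatV a b ≠ IVal.poison := by
  simp [sshlSatV, ushlSatV, Nat.not_le.mpr h]

/-! ## `llvm.bswap`: consequences of the byte permutation (API for rule proofs; appended, lit gen 14)

Everything below follows from the typed sentence "if the input bytes are numbered 0, 1, 2, 3 then the returned i32 will have its bytes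
in 3, 2, 1, 0 order […] other intrinsics extend this concept to additional even-byte lengths" (L16133–16140): `bswapV` PERMUTES bit
positions (byte `j ↦ B−1−j`, offset kept), so it commutes with every bitwise-pointwise operation, is an involution on whole-byte widths,
and exchanges left and right shifts by whole bytes.  Stated for `w % 8 = 0` where the byte structure is needed (the typed widths
`BswapTyped w`, `w % 16 = 0`, are among these). -/

/-- The source bit index of `bswapV` stays below the width (so `bswapV` never reads a non-existent bit).
[cite: LLVMLangRef18, §'llvm.bswap.*' L16133–16140] -/
theorem bswap_index_lt {i : ℕ} (hi : i < w) : 8 * (w / 8 - 1 - i / 8) + i % 8 < w := by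
  omega

/-- On whole-byte widths the byte permutation is an involution on indices: applying `j ↦ B−1−j` twice is the identity.
[cite: LLVMLangRef18, §'llvm.bswap.*' L16133–16140] -/
theorem bswap_index_invol (hw : w % 8 = 0) {i : ℕ} (hi : i < w) :
    8 * (w / 8 - 1 - (8 * (w / 8 - 1 - i / 8) + i % 8) / 8) + (8 * (w / 8 - 1 - i / 8) + i % 8) % 8 = i := by
  omega

/-- A bitwise-pointwise binary operation commutes with the byte swap (both sides combine the same pair of input bits).
[cite: LLVMLangRef18, §'llvm.bswap.*' L16133–16140] -/
theorem bswapV_bitwise (op : BitVec w → BitVec w → BitVec w) (f : Bool → Bool → Bool)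
    (h : ∀ (a b : BitVec w) (i : ℕ), i < w → (op a b).getLsbD i = f (a.getLsbD i) (b.getLsbD i)) (x y : BitVec w) :
    op (bswapV x) (bswapV y) = bswapV (op x y) := by
  apply BitVec.eq_of_getLsbD_eq
  intro i hi
  rw [h _ _ _ hi, getLsbD_bswapV, getLsbD_bswapV, getLsbD_bswapV, h _ _ _ (bswap_index_lt hi)]
  simp [hi]

/-- `bswap x & bswap y = bswap (x & y)`. [cite: LLVMLangRef18, §'llvm.bswap.*' L16133–16140] -/
theorem bswapV_and (x y : BitVec w) : bswapV x &&& bswapV y = bswapV (x &&& y) :=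
  bswapV_bitwise (· &&& ·) (· && ·) (fun _ _ _ _ => BitVec.getLsbD_and) x y

/-- `bswap x | bswap y = bswap (x | y)`. [cite: LLVMLangRef18, §'llvm.bswap.*' L16133–16140] -/
theorem bswapV_or (x y : BitVec w) : bswapV x ||| bswapV y = bswapV (x ||| y) :=
  bswapV_bitwise (· ||| ·) (· || ·) (fun _ _ _ _ => BitVec.getLsbD_or) x y

/-- `bswap x ^ bswap y = bswap (x ^ y)`. [cite: LLVMLangRef18, §'llvm.bswap.*' L16133–16140] -/
theorem bswapV_xor (x y : BitVec w) : bswapV x ^^^ bswapV y = bswapV (x ^^^ y) :=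
  bswapV_bitwise (· ^^^ ·) (fun a b => a ^^ b) (fun _ _ _ _ => BitVec.getLsbD_xor) x y

/-- `~(bswap x) = bswap (~x)`. [cite: LLVMLangRef18, §'llvm.bswap.*' L16133–16140] -/
theorem bswapV_not (x : BitVec w) : ~~~(bswapV x) = bswapV (~~~x) := by
  apply BitVec.eq_of_getLsbD_eq
  intro i hi
  rw [BitVec.getLsbD_not, getLsbD_bswapV, getLsbD_bswapV, BitVec.getLsbD_not]
  simp [hi, bswap_index_lt hi]

/-- On whole-byte widths `bswap` is an involution: "swapped" twice is the identity. [cite: LLVMLangRef18, §'llvm.bswap.*' L16133–16140] -/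
theorem bswapV_bswapV (hw : w % 8 = 0) (x : BitVec w) : bswapV (bswapV x) = x := by
  apply BitVec.eq_of_getLsbD_eq
  intro i hi
  rw [getLsbD_bswapV, getLsbD_bswapV, bswap_index_invol hw hi]
  simp [hi, bswap_index_lt hi]

/-- Hence `bswap` is injective on whole-byte widths: `bswap x = bswap y ↔ x = y`. [cite: LLVMLangRef18, §'llvm.bswap.*' L16133–16140] -/
theorem bswapV_inj (hw : w % 8 = 0) {x y : BitVec w} : bswapV x = bswapV y ↔ x = y := by
  constructor
  · intro h
    rw [← bswapV_bswapV hw x, ← bswapV_bswapV hw y, h]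
  · rintro rfl
    rfl

/-- The typed widths are whole-byte widths. [cite: LLVMLangRef18, §'llvm.bswap.*' L16113–16114] -/
theorem BswapTyped.mod_eight {w : ℕ} (h : BswapTyped w) : w % 8 = 0 := by
  unfold BswapTyped at h
  omega

/-- Byte swap turns a left shift by whole bytes into a right shift by the same bytes: `bswap (x << 8k) = (bswap x) >> 8k`
(whole-byte widths). [cite: LLVMLangRef18, §'llvm.bswap.*' L16133–16140] -/
theorem bswapV_shiftLeft (hw : w % 8 = 0) (x : BitVec w) (k : ℕ) : bswapV (x <<< (8 * k)) = bswapV x >>> (8 * k) := by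
  apply BitVec.eq_of_getLsbD_eq
  intro i hi
  rw [getLsbD_bswapV, BitVec.getLsbD_shiftLeft, BitVec.getLsbD_ushiftRight, getLsbD_bswapV]
  simp only [hi, decide_true, Bool.true_and, bswap_index_lt hi]
  by_cases hk : 8 * k + i < w
  · rw [decide_eq_true hk, Bool.true_and, decide_eq_false (by omega : ¬(8 * (w / 8 - 1 - i / 8) + i % 8 < 8 * k)),
      Bool.not_false, Bool.true_and, show 8 * (w / 8 - 1 - i / 8) + i % 8 - 8 * k = 8 * (w / 8 - 1 - (8 * k + i) / 8) + (8 * k + i) % 8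
        by omega]
  · rw [decide_eq_false hk, Bool.false_and, decide_eq_true (by omega : 8 * (w / 8 - 1 - i / 8) + i % 8 < 8 * k)]
    simp

/-- … and a right shift by whole bytes into a left shift: `bswap (x >> 8k) = (bswap x) << 8k` (whole-byte widths).
[cite: LLVMLangRef18, §'llvm.bswap.*' L16133–16140] -/
theorem bswapV_ushiftRight (hw : w % 8 = 0) (x : BitVec w) (k : ℕ) : bswapV (x >>> (8 * k)) = bswapV x <<< (8 * k) := by
  have h := bswapV_shiftLeft hw (bswapV x) k
  rw [bswapV_bswapV hw] at h
  rw [← h, bswapV_bswapV hw]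

/-- The printed example shape at `i32`: swapping the bytes of `0x12345678` gives `0x78563412`, and swapping again gives the input back.
[cite: LLVMLangRef18, §'llvm.bswap.*' L16134–16137] -/
theorem bswapV_example_i32 : bswapV (0x12345678#32) = 0x78563412#32 ∧ bswapV (0x78563412#32) = 0x12345678#32 := by
  constructor <;> (rw [bswapV_i32]; decide)

end Literature.Computability.LLVMLangRef18
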